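import Summits.BirchSwinnertonDyer.Rank1Residual.X11b.AnticyclotomicControlAtoms
import Summits.BirchSwinnertonDyer.Rank1Residual.X11b.AnticyclotomicStrictDescent
import HarnessLib

/-!
# X11b, route R1 — the local Tamagawa atom (P11) PROVED where the local kernel is trivial:
# `E(K_w)[p] = 0 ⟹ ker(H¹(K_w, E[p^∞]) → H¹(K_{∞,η}, E[p^∞])) = 0`, hence (P11) at every `w ∈ Σ(N⁺)`
# with `E(K_w)[p] = 0` and `p ∤ c_w(E/K)`

HONEST FRAMING (cell `b2b-bsdres`, run/shared/lean/b2b/bsd-rank1-residual/, verbatim in every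
file): the goal of the cell is to DELETE the COMBINATION-SHAPED residual classes of the
Birch–Swinnerton-Dyer formula for ALL analytic-rank `≤ 1` elliptic curves over `ℚ` — "full BSD
formula for every rank `≤ 1` curve in class `C`" assembled STRICTLY from published theorems — so
that the rank-`≤ 1` remainder becomes exactly the CONSTRUCTION-SHAPED classes, which are TYPED
(missing-input `Prop`s), NOT attempted. This is not "finishing BSD". Sub-cell
`b2b-bsdres-multr1-p1` (X11b, route R1 = Castella 2018 Thm. A re-proved along the author's
erratum); a RESEARCH ROUTE; no claim beyond the stated class; X11b stays CONSTRUCTION-SHAPED;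
nothing here changes a label; no named fact is minted (theorems only; no `sorry`).

## What this file proves

The local atom (P11) `LocalKernelOrderAt E p κ w` of `AnticyclotomicControlAtoms` (JSW17 Prop. 3.3.4
Case 1(a) / Greenberg LNM 1716 pp. 74–75: `#ker r_w = c_w^{(p)}`) in the case where BOTH sides are
trivial, for EVERY `E/K`, EVERY `ℤ_p`-extension `κ`, EVERY finite place `w` (no reduction-type, no
decomposition hypothesis):

* `AcSelmer.localKer_eq_bot_of_fixedPoints_eq_bot` — `E(K̄)[p^∞]^{D_w ⊓ ker κ} = 0 ⟹ ker r_w = 0`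
  (inflation–restriction with trivial fixed part, gen 10's `resOfLe_injective_of_fixedPoints`:
  `ker r_w ≅ H¹(D_w/(D_w ⊓ ker κ), E(K_{∞,η})[p^∞])`);
* `AcSelmer.localKer_eq_bot_of_noPTorsion` — **`E(K_w)[p] = 0 ⟹ ker r_w = 0`**: Galois descent
  (`eq_zero_of_fixed_decomp_of_local`: `E(K̄)[p^∞]^{D_w}[p] = 0`) and pro-`p` descent along the tower
  (`fixedPoints_decomp_inf_kerSubgroup_eq_bot`: a pro-`p` group acting on a non-zero finite `p`-group
  has a non-zero fixed point, so `E(K_{∞,η})[p^∞] = 0`) — the argument gen 10 ran at the strict place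
  `𝔭`, now at an arbitrary place;
* `noPTorsion_baseChange_adicCompletion_of_ringHom` — transport of "`E(L)[p] = 0`" along a ring map
  `K_w → L` (with the tree's `K_w → ℚ_ℓ` at a degree-one `w ∣ ℓ`), so that at a split `ℓ` the
  hypothesis reads `E(ℚ_ℓ)[p] = 0` (decidable: `p ∤ #E(ℚ_ℓ)_tors`);
* **`localKernelOrderAt_of_noPTorsion_of_not_dvd`** — `E(K_w)[p] = 0 ∧ p ∤ c_w(E/K) ⟹ (P11) at `w`**;
  `localKernelOrderAt_of_padic_noPTorsion_of_not_dvd` — the same from `E(ℚ_ℓ)[p] = 0` at a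
  degree-one `w ∣ ℓ`;
* route R1: `controlOnTreeAt_of_poitouTateAtoms_of_local` — at a datum where EVERY `w ∈ Σ(N⁺)` has
  `E(K_w)[p] = 0` and `p ∤ c_w(E/K)` (e.g. `p ∤ c_ℓ(E)·#Ẽ_ns(𝔽_ℓ)` for every `ℓ ∣ N`, `ℓ ∉ {p, q}`),
  Cas18 Thm. 2.3 `ControlOnTreeAt` follows from the three Poitou–Tate atoms (P6), (P9), (L10) ALONE.

Where (P11) is NOT settled here: `w ∈ Σ(N⁺)` with `E(K_w)[p] ≠ 0` (`p ∣ #Ẽ_ns(𝔽_ℓ)·c_ℓ`) — there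
`E(K_{∞,η})[p^∞] ≠ 0` and the order of `H¹(Γ_w, E(K_{∞,η})[p^∞])` is the Tate-curve computation
(`μ_{p^∞}`-part divisible by `γ_w − 1`, component part of order `c_w^{(p)}`; tree named facts
`Silverman1994_thmV53_…`), and `w` must be finitely decomposed in `K_∞^{ac}` (class field theory).

References: [JetchevSkinnerWan2017] Prop. 3.3.4 (arXiv:1512.06894 pp. 12–13); [GreenbergLNM1716] §3
pp. 74–75, Lemma 3.3 (p. 87); [Castella2018Erratum] Thm. 1.1 (iv), Lemma 2.1 (pp. 1–2);
[SerreGaloisCohomology1997] I.§2.6 (b).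
-/

noncomputable section

open scoped Classical

open WeierstrassCurve NumberField IsDedekindDomain Field
open Literature.NumberTheory.EllipticCurves Literature.NumberTheory.EllipticCurves.GreenbergSelmer
open Literature.NumberTheory.EllipticCurves.Rank1Residual
open Literature.NumberTheory.EllipticCurves.Rank1Residual.Typed
open Literature.NumberTheory.GaloisRepresentations
open Summit.BirchSwinnertonDyer.Rank1Residual.X11b.AcSelmer

namespace Summit.BirchSwinnertonDyer.Rank1Residual.X11b

/-! ## `ker r_w = 0` from `E(K_w)[p] = 0` -/

section LocalKer

variable {K : Type} [Field K] [NumberField K] (E : WeierstrassCurve K) [E.IsElliptic] (p : ℕ)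
  [Fact p.Prime] (κ : ZpExtension K p) (v : HeightOneSpectrum (𝓞 K))

omit [E.IsElliptic] in
/-- **`E(K̄)[p^∞]^{D_w ⊓ ker κ} = 0 ⟹ ker r_w = 0`**: the local kernel
`ker(H¹(K_w, E[p^∞]) → H¹(K_{∞,η}, E[p^∞]))` (the sibling's `AcSelmer.localKer`, restriction
`H¹(⊤ ⊓ D_w) → H¹(ker κ ⊓ D_w)`) vanishes when `E(K_{∞,η})[p^∞] = 0` (inflation–restriction:
`ker r_w ≅ H¹(D_w/(D_w ⊓ ker κ), E[p^∞]^{D_w ⊓ ker κ})`). Any `E/K`, any `ℤ_p`-extension, any place.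
[cite: GreenbergLNM1716, §3 p. 87 ("`ker(r_v) ≅ H¹(K_{∞,η}/K_v, E(K_{∞,η})[p^∞])`")] [cite: SerreGaloisCohomology1997, I.§2.6 (b)] -/
theorem AcSelmer.localKer_eq_bot_of_fixedPoints_eq_bot
    (h0 : FixedPoints.addSubgroup ↥(decomp v ⊓ κ.kerSubgroup) (E.geomPrimaryTorsion p) = ⊥) :
    AcSelmer.localKer κ.kerSubgroup (E.geomPrimaryTorsion p) v = ⊥ := by
  rw [AcSelmer.localKer, AddMonoidHom.ker_eq_bot_iff]
  haveI : ((κ.kerSubgroup ⊓ decomp v).subgroupOf ((⊤ : Subgroup (absoluteGaloisGroup K)) ⊓ decomp v)).Normal :=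
    Subgroup.inf_subgroupOf_inf_normal_of_left (decomp v)
  refine AcSelmer.resOfLe_injective_of_fixedPoints _ inferInstance
    (E.continuous_smul_geomPrimaryTorsion p) fun m hm ↦ ?_
  have : m ∈ FixedPoints.addSubgroup ↥(decomp v ⊓ κ.kerSubgroup) (E.geomPrimaryTorsion p) :=
    fun x ↦ hm x (Subgroup.mem_inf.mpr
      ⟨(Subgroup.mem_inf.mp x.2).2, (Subgroup.mem_inf.mp x.2).1⟩)
  rwa [h0, AddSubgroup.mem_bot] at this

/-- **`E(K_w)[p] = 0 ⟹ ker r_w = 0`** for EVERY `E/K`, EVERY `ℤ_p`-extension `κ` of `K` and EVERY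
finite place `w`: Galois descent (`E(K̄)[p^∞]^{D_w}[p] = 0`, `eq_zero_of_fixed_decomp_of_local`) and
pro-`p` descent along `K_{∞,η}/K_w` (`fixedPoints_decomp_inf_kerSubgroup_eq_bot`: `E(K_{∞,η})[p^∞] =
0`), then `localKer_eq_bot_of_fixedPoints_eq_bot`. (Greenberg, p. 75: "if `E(K_v)` has no point of
order `p` … `ker(r_v) = 0`".) [cite: GreenbergLNM1716, §3 pp. 74–75 and Lemma 3.3 (p. 87)] [cite: Castella2018Erratum, Thm. 1.1 (iv), Lemma 2.1 (pp. 1–2)] -/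
theorem AcSelmer.localKer_eq_bot_of_noPTorsion
    (hKv : ∀ R : ((E.baseChange (v.adicCompletion K))).toAffine.Point, p • R = 0 → R = 0) :
    AcSelmer.localKer κ.kerSubgroup (E.geomPrimaryTorsion p) v = ⊥ :=
  AcSelmer.localKer_eq_bot_of_fixedPoints_eq_bot E p κ v
    (fixedPoints_decomp_inf_kerSubgroup_eq_bot κ E v fun m hfix hpm ↦
      eq_zero_of_fixed_decomp_of_local E p v hKv m hfix hpm)

/-- **(P11) at `w` from `E(K_w)[p] = 0` and `p ∤ c_w(E/K)`**: both sides of JSW17 Prop. 3.3.4 Case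
1(a)'s identity `#ker r_w = c_w^{(p)}` are `1`. Any `E/K`, `κ`, `w`.
[cite: JetchevSkinnerWan2017, Prop. 3.3.4 (arXiv:1512.06894 pp. 12–13)] [cite: GreenbergLNM1716, §3 pp. 74–75] -/
theorem localKernelOrderAt_of_noPTorsion_of_not_dvd
    (hKv : ∀ R : ((E.baseChange (v.adicCompletion K))).toAffine.Point, p • R = 0 → R = 0)
    (hc : ¬ p ∣ (E.baseChange (v.adicCompletion K)).localTamagawaNumber (v.adicCompletionIntegers K)) :
    LocalKernelOrderAt E p κ v := by
  have hbot := AcSelmer.localKer_eq_bot_of_noPTorsion E p κ v hKv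
  refine ⟨?_, ?_⟩
  · rw [hbot]; infer_instance
  · rw [hbot, AddSubgroup.card_bot, padicValNat.eq_zero_of_not_dvd hc, pow_zero]

end LocalKer

/-! ## Transport: `E(ℚ_ℓ)[p] = 0 ⟹ E(K_w)[p] = 0` at a degree-one `w ∣ ℓ` -/

section Transport

variable {K : Type} [Field K] [NumberField K] (W : WeierstrassCurve ℚ) [W.IsElliptic] (p : ℕ)

omit [W.IsElliptic] in
/-- **`E(L)[p] = 0 ⟹ E(K_w)[p] = 0`** along any ring map `K_w → L` of fields (points map injectively,
`Affine.Point.map_injective`; `(W_K)_{K_w} = W_{K_w}`). [cite: SilvermanAEC2009, VII.§1 (points over field extensions)] -/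
theorem noPTorsion_baseChange_adicCompletion_of_ringHom (w : HeightOneSpectrum (𝓞 K)) {L : Type}
    [Field L] [CharZero L] (e : w.adicCompletion K →+* L)
    (hL : ∀ P : (W.baseChange L).toAffine.Point, p • P = 0 → P = 0) :
    ∀ R : ((W.baseChange K).baseChange (w.adicCompletion K)).toAffine.Point, p • R = 0 → R = 0 := by
  have hW : (W.baseChange K).baseChange (w.adicCompletion K) = W.baseChange (w.adicCompletion K) :=
    W.map_baseChange (algebraMap K (w.adicCompletion K)).toRatAlgHom
  rw [hW]
  intro R hR
  have hmap := hL (WeierstrassCurve.Affine.Point.map e.toRatAlgHom R)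
    (by rw [← map_nsmul, hR, map_zero])
  exact WeierstrassCurve.Affine.Point.map_injective (W' := W) e.toRatAlgHom (by rw [hmap, map_zero])

variable [Fact p.Prime]

/-- **(P11) at a degree-one `w ∣ ℓ` from `E(ℚ_ℓ)[p] = 0` and `p ∤ c_w(E/K)`.** For `w ∈ Σ(N⁺)`
(`e = f = 1`, so `K_w ≃ ℚ_ℓ`: the tree's `exists_ringHom_adicCompletion_padic_of_degreeOne`): if
`E(ℚ_ℓ)` has no point of order `p` (e.g. `p ∤ c_ℓ(E)·#Ẽ_ns(𝔽_ℓ)`, `ℓ ≠ p`) and `p ∤ c_w(E/K)`, then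
`#ker r_w = 1 = c_w^{(p)}`. [cite: JetchevSkinnerWan2017, Prop. 3.3.4 (arXiv:1512.06894 pp. 12–13)] [cite: GreenbergLNM1716, §3 pp. 74–75] -/
theorem localKernelOrderAt_of_padic_noPTorsion_of_not_dvd (κ : ZpExtension K p)
    (w : HeightOneSpectrum (𝓞 K)) (ℓ : ℕ) [Fact ℓ.Prime] (hℓw : ((ℓ : ℕ) : 𝓞 K) ∈ w.asIdeal)
    (he : w.asIdeal.ramificationIdx (𝓞 ℚ) = 1) (hf : w.asIdeal.inertiaDeg (𝓞 ℚ) = 1)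
    (hℓ : ∀ P : (W.baseChange ℚ_[ℓ]).toAffine.Point, p • P = 0 → P = 0)
    (hc : ¬ p ∣ ((W.baseChange K).baseChange (w.adicCompletion K)).localTamagawaNumber
      (w.adicCompletionIntegers K)) :
    LocalKernelOrderAt (W.baseChange K) p κ w := by
  haveI : (W.baseChange K).IsElliptic := by rw [baseChange]; infer_instance
  obtain ⟨e⟩ := exists_ringHom_adicCompletion_padic_of_degreeOne (p := ℓ) w hℓw he hf
  exact localKernelOrderAt_of_noPTorsion_of_not_dvd (W.baseChange K) p κ w
    (noPTorsion_baseChange_adicCompletion_of_ringHom W p w e hℓ) hc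

end Transport

/-! ## Route R1: where every local atom is trivial, (CTL) is the three Poitou–Tate atoms -/

section RouteR1

variable {W : WeierstrassCurve ℚ} [W.IsElliptic] [W.IsGloballyMinimal] {K : Type} [Field K]
  [NumberField K] {p : ℕ} [Fact p.Prime]

/-- **Cas18 Thm. 2.3 from the Poitou–Tate atoms ALONE where the local kernels are trivial.** On the
A′-hypotheses, for `K` imaginary quadratic with `p` split, an anticyclotomic `κ` with topological
generator `γ`, a degree-one `𝔭 ∣ p`, any `ι`, `P`: if at EVERY `w ∈ Σ(N⁺)` one has `E(K_w)[p] = 0` and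
`p ∤ c_w(E/K)` (then (P11) is the theorem `localKernelOrderAt_of_noPTorsion_of_not_dvd`), then
(P6) ∧ (P9) ∧ (L10) ⟹ `ControlOnTreeAt p κ 𝔭 γ ι P`, with `ord_p ∏_{w∣N⁺} c_w = Σ_{w∣p} ord_p c_w`.
[cite: Castella2018, Thm. 2.3 (arXiv:1704.06608 p. 5)] [cite: JetchevSkinnerWan2017, Thm. 3.3.1 and Prop. 3.3.4 (arXiv:1512.06894 pp. 11–13)] -/
theorem controlOnTreeAt_of_poitouTateAtoms_of_local (hE : ErratumHypotheses W p)
    (hK : IsImaginaryQuadratic K) (hsplit : SplitsIn K p) {κ : ZpExtension K p}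
    (hκ : κ.IsAnticyclotomic) (γ : absoluteGaloisGroup K) [Fact (κ.IsTopGenerator γ)]
    (𝔭 : HeightOneSpectrum (𝓞 K)) (h𝔭 : ((p : ℕ) : 𝓞 K) ∈ 𝔭.asIdeal)
    (he : 𝔭.asIdeal.ramificationIdx (𝓞 ℚ) = 1) (hf : 𝔭.asIdeal.inertiaDeg (𝓞 ℚ) = 1)
    (ι : K →+* ℚ_[p]) (P : (W.baseChange K).toAffine.Point)
    (h6 : BaseSelmerCountAt p 𝔭 ι P)
    (h9 : LocSurjAt (W.baseChange K) p 𝔭 (nPlusPlaces_finite (W := W) (p := p) hK.1))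
    (h10 : CoinvariantsTrivialAt (W.baseChange K) p κ 𝔭 γ)
    (hloc : ∀ v ∈ nPlusPlaces W K p,
      (∀ R : ((W.baseChange K).baseChange (v.adicCompletion K)).toAffine.Point, p • R = 0 → R = 0) ∧
        ¬ p ∣ ((W.baseChange K).baseChange (v.adicCompletion K)).localTamagawaNumber
          (v.adicCompletionIntegers K)) :
    ControlOnTreeAt p κ 𝔭 γ ι P :=
  controlOnTreeAt_of_atoms hE hK hsplit hκ γ 𝔭 h𝔭 he hf ι P h6 h9 h10 fun v hv ↦
    localKernelOrderAt_of_noPTorsion_of_not_dvd (W.baseChange K) p κ v (hloc v hv).1 (hloc v hv).2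

end RouteR1

end Summit.BirchSwinnertonDyer.Rank1Residual.X11b

end
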